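import Literature.AlgebraicGeometry.HodgeTheory.GeometricConiveauOfProductsSmallChowGroups
import Literature.AlgebraicGeometry.Motives.FanoRationallyChainConnected
import HarnessLib

/-!
# Rationally chain connected ⟹ `CH₀ ⊗ ℚ` of rank `≤ 1` in the tree's cycle-level spelling (`Motives.ChowRankLEOneUpTo X 0`) — the bridge between the two `CH₀`-hypotheses of the tree — and its Hodge
# consequences: `HC` for every rationally chain connected (e.g. Fano) variety of dimension `≤ 5`, all of Grothendieck's amended `GHC` in dimension `≤ 4` and for `T × T'`, `C × T`, `T × C` with `T, T'`
# rationally chain connected threefolds, `HC(Y × Z)` for rationally chain connected factors with `dim Y + dim Z ≤ 7`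
# (Kollár 1996 Def. 4.10; KMM 1992 Thm. 3.3; Voisin II Thm. 10.17, Prop. 10.26, Thm. 10.29/10.31; Bloch–Srinivas 1983; Laterveer 1998; Vial 2013 Thm. 7.1; Grothendieck 1969)

Family `hodge`, lane `lit-hodgefound` (Track 2 foundations library; Layers A1/A4), layer `Literature/AlgebraicGeometry/HodgeTheory`.  THEOREMS ONLY (no definition, no named fact, no instance;
D-0026 net debt `0`).  The tree carries two renderings of «`CH₀(X)` is small»: `Barriers.HodgeConjecture.HasChowZeroSupportedInDimLE X 0` (supported on a finite set of closed points; fed by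
`IsRationallyChainConnected.hasChowZeroSupportedInDimLE_zero`) and `Motives.ChowRankLEOneUpTo X 0` (any two `0`-cycles `ℤ`-linearly dependent modulo rational equivalence; consumed by the generalised
decomposition of the diagonal and by the seat's g33-#7 – g33-#12).  This file proves the missing bridge from rational chain connectedness to the second rendering, by the bookkeeping of the tree's
`chowZeroSupportedOn_of_forall_point`: a `0`-cycle `c` on the compact `X(ℂ)`-side scheme has finite support and equals `Σ_z c(z)·[z]`; all closed points are rationally equivalent to a fixed closed
point `x₀` (`IsRationallyChainConnected.isRationallyEquivalent_primeCycle`), so `c ∼ (Σ_z c(z))·[x₀]`, and two multiples of `[x₀]` are `ℤ`-dependent.  Then every `ChowRankLEOneUpTo _ 0` theorem of the seat's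
series applies to rationally chain connected — in particular (granted the typed fact `KollarMiyaokaMori1992_fano_rationallyChainConnected`) to FANO — varieties.

WHAT IS PROVED (`0` sorrys; every statement a theorem).
* §1 **`Motives.IsRationallyChainConnected.chowRankLEOneUpTo_zero`**, `KollarMiyaokaMori1992_fano_rationallyChainConnected.chowRankLEOneUpTo_zero`.
* §2 `hodgeConjectureFor_of_isRationallyChainConnected` (`dim ≤ 5`), `forall_generalHodgePropertyFor_of_isRationallyChainConnected` (`dim ≤ 4`), `forall_generalHodgePropertyFor_dim_five_iff_of_isRationallyChainConnected`;
  products: `hodgeConjectureFor_tensor_of_isRationallyChainConnected_of_add_le_seven` (`dim Y, dim Z ≤ 5`, `dim Y + dim Z ≤ 7`; the Summit-side `Theorems/ThreefoldConiveauOneOddPieces` has the case of two threefolds), `hodgeConjectureFor_tensor_of_isRationallyChainConnected_of_dim_le_three` (second factor arbitrary of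
  dimension `≤ 3`, `dim Y + dim Z ≤ 5`), **`forall_generalHodgePropertyFor_tensor_threefolds_of_isRationallyChainConnected`** (ALL of `GHC(T × T')`), `forall_generalHodgePropertyFor_curve_tensor_threefold_of_isRationallyChainConnected`
  (+ mirror); and the FANO forms of all of these granted KMM92.

THE PRINTS.  J. Kollár (1996) [Kollar1995] Def. 4.10, (4.12.1); J. Kollár, Y. Miyaoka, S. Mori (1992) [KollarMiyaokaMori1992] Thm. 3.3; C. Voisin (2003) [VoisinHodgeII2003] §10.2.2 Thm. 10.17, Cor. 10.18, §10.2.3 Prop. 10.26 and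
the remark following it, §10.3.1 Thm. 10.29, Thm. 10.31, §9.2.4 Prop. 9.20; S. Bloch, V. Srinivas (1983) [BlochSrinivas1983] Thm. 1; R. Laterveer (1998) [Laterveer1998]; Ch. Vial (2013) [Vial2013] Thm. 7.1;
A. Grothendieck (1969) [GrothendieckTopology1969] §1; W. Fulton (1998) [Fulton1998] §1.3; C. Voisin (2002) [VoisinHodgeI2002] §11.3.3 Thm. 11.38.

THE OBJECTS (all the tree's).  `IsRationallyChainConnected`, `IsFano`, `KollarMiyaokaMori1992_fano_rationallyChainConnected` (hypothesis only), `Motives.ChowRankLEOneUpTo`, `Motives.cyclesOfDim`, `Motives.primeCycle`,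
`Motives.IsRationallyEquivalent`, `Motives.ratTrivial`, `HodgeConjectureFor`, `GeneralHodgePropertyFor`; the tree's `IsRationallyChainConnected.isRationallyEquivalent_primeCycle`, `Motives.finite_support_of_compactSpace`,
`Motives.eq_sum_smul_primeCycle_of_support_subset`, `nonempty_inter_closedPoints`, `ProjFamily.height_eq_zero_of_isClosed_singleton`, and the seat's g33-#7/#9/#11 theorems.

DEVIATIONS / SCOPE.  Over `ℂ` (the ambient field of `IsSmoothProjective`); `Motives.ChowRankLEOneUpTo X 0` is the rank-`≤ 1` statement for `0`-CYCLES modulo `Rat₀`, exactly as consumed downstream.  The Fano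
corollaries are conditional on the typed KMM92 fact, as everywhere in the tree.

## References
* [Kollar1995] J. Kollár, *Rational Curves on Algebraic Varieties* — Def. 4.10 (4.10.1), (4.12.1) (pp. 46–47).
* [KollarMiyaokaMori1992] J. Kollár, Y. Miyaoka, S. Mori, J. Differential Geom. 36 (1992) — Thm. 3.3.
* [VoisinHodgeII2003] C. Voisin, *Hodge Theory and Complex Algebraic Geometry II* — Thm. 10.17, Cor. 10.18, Prop. 10.26 (and remark), Thm. 10.29, Thm. 10.31, Prop. 9.20.
* [BlochSrinivas1983] S. Bloch, V. Srinivas, Amer. J. Math. 105 (1983) — Thm. 1.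
* [Laterveer1998] R. Laterveer, J. Math. Kyoto Univ. 38 (1998) — main theorem.
* [Vial2013] Ch. Vial, Doc. Math. 18 (2013) — Thm. 7.1.
* [GrothendieckTopology1969] A. Grothendieck, Topology 8 (1969) — §1, pp. 300–301.
* [Fulton1998] W. Fulton, *Intersection Theory* — §1.3.
* [VoisinHodgeI2002] C. Voisin, *Hodge Theory and Complex Algebraic Geometry I* — §11.3.3 Thm. 11.38.

## Provenance
Lane `lit-hodgefound` (summit `HodgeConjecture`, Track 2 foundations), seat `lit-hodgefound-p29` (literature-prover, generation 33, row g33-#13).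
-/

noncomputable section

open CategoryTheory AlgebraicGeometry MonoidalCategory Order

namespace Literature.AlgebraicGeometry.Motives

/-! ### §1 Rationally chain connected ⟹ `ChowRankLEOneUpTo X 0` -/

/-- **A rationally chain connected smooth projective complex variety has `CH₀ ⊗ ℚ` of rank `≤ 1` in the cycle-level sense `Motives.ChowRankLEOneUpTo X 0`**: every `0`-cycle `c` is a finite sum
`Σ_z c(z)·[z]` of closed points (compactness), each `[z]` is rationally equivalent to `[x₀]` for a fixed closed point `x₀` (chains of rational curves), so `c ∼ (Σ_z c(z))·[x₀]`; for two cycles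
`c ∼ m·[x₀]`, `c' ∼ m'·[x₀]` one has `m'·c ∼ m·c'` (and `1·c ∼ 1·c'` if `m = m' = 0`). [cite: Kollar1995, Def. 4.10 (4.10.1) and (4.12.1) (pp. 46–47)] [cite: VoisinHodgeII2003, remark following Prop. 10.26 (§10.2.3)]
[cite: Fulton1998, §1.3] -/
theorem IsRationallyChainConnected.chowRankLEOneUpTo_zero {n : ℕ} {X : SchemeOver ℂ} (hX : IsSmoothProjective n X) (h : IsRationallyChainConnected X) : ChowRankLEOneUpTo X 0 := by
  classical
  haveI : IsProper X.hom := IsSmoothProjective.isProper_holds hX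
  haveI : IsIntegral X.left := IsSmoothProjective.isIntegral_holds hX
  haveI : LocallyOfFiniteType X.hom := inferInstance
  haveI : JacobsonSpace ↥X.left := LocallyOfFiniteType.jacobsonSpace X.hom
  haveI : CompactSpace ↥X.left := IsSmoothProjective.compactSpace_holds hX
  obtain ⟨x⟩ := (inferInstance : Nonempty ↥X.left)
  obtain ⟨x₀, -, hx₀⟩ := nonempty_inter_closedPoints (Z := (Set.univ : Set ↥X.left)) ⟨x, trivial⟩ isClosed_univ.isLocallyClosed
  have h0 : height x₀ = 0 := ProjFamily.height_eq_zero_of_isClosed_singleton hx₀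
  -- every `0`-cycle is rationally equivalent to a multiple of `[x₀]`
  have key : ∀ c ∈ cyclesOfDim X.left 0, ∃ m : ℤ, IsRationallyEquivalent c (m • primeCycle x₀) 0 := by
    intro c hc
    set s : Finset X.left := (finite_support_of_compactSpace c).toFinset with hs_def
    have hsub : Function.support ⇑c ⊆ (s : Set X.left) := by simp [hs_def]
    have hz0 : ∀ z ∈ s, height z = 0 := fun z hz ↦ by
      have hz' : c z ≠ 0 := by simpa [hs_def] using hz
      simpa using hc z hz'
    refine ⟨∑ z ∈ s, c z, ?_⟩
    have hc' : c = ∑ z ∈ s, c z • primeCycle z := eq_sum_smul_primeCycle_of_support_subset c hsub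
    have hsum : ∑ z ∈ s, c z • (primeCycle z - primeCycle x₀) = c - (∑ z ∈ s, c z) • primeCycle x₀ := by
      simp only [smul_sub, Finset.sum_sub_distrib, Finset.sum_smul]
      rw [← hc']
    change c - (∑ z ∈ s, c z) • primeCycle x₀ ∈ ratTrivial X.left 0
    rw [← hsum]
    exact AddSubgroup.sum_mem _ fun z hz ↦ AddSubgroup.zsmul_mem _ (h.isRationallyEquivalent_primeCycle (hz0 z hz) h0) _
  intro j hj c hc c' hc'
  obtain rfl : j = 0 := Nat.le_zero.mp hj
  obtain ⟨m, hm⟩ := key c hc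
  obtain ⟨m', hm'⟩ := key c' hc'
  by_cases hmm : m = 0 ∧ m' = 0
  · obtain ⟨rfl, rfl⟩ := hmm
    refine ⟨1, 1, Or.inl one_ne_zero, ?_⟩
    rw [one_smul, one_smul]
    rw [zero_smul] at hm hm'
    exact hm.trans hm'.symm
  · refine ⟨m', m, by omega, ?_⟩
    -- `m'•c − m•c' = m'•(c − m•[x₀]) − m•(c' − m'•[x₀])`
    have hlin : m' • c - m • c' = m' • (c - m • primeCycle x₀) - m • (c' - m' • primeCycle x₀) := by
      rw [smul_sub, smul_sub, smul_smul, smul_smul, mul_comm m' m]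
      abel
    change m' • c - m • c' ∈ ratTrivial X.left 0
    rw [hlin]
    exact (ratTrivial X.left 0).sub_mem ((ratTrivial X.left 0).zsmul_mem hm _) ((ratTrivial X.left 0).zsmul_mem hm' _)

/-- **Smooth complex FANO varieties have `CH₀ ⊗ ℚ` of rank `≤ 1` (`Motives.ChowRankLEOneUpTo X 0`), granted the printed fact that Fano manifolds are rationally chain connected.**
[cite: KollarMiyaokaMori1992, Thm. 3.3] [cite: Kollar1995, Def. 4.10 (4.10.1) and (4.12.1) (pp. 46–47)] -/
theorem KollarMiyaokaMori1992_fano_rationallyChainConnected.chowRankLEOneUpTo_zero {n : ℕ} {X : SchemeOver ℂ} (h : KollarMiyaokaMori1992_fano_rationallyChainConnected)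
    (hX : IsFano n X) : ChowRankLEOneUpTo X 0 :=
  (h hX).chowRankLEOneUpTo_zero hX.isSmoothProjective

end Literature.AlgebraicGeometry.Motives

namespace Literature.AlgebraicGeometry.HodgeTheory

open Literature.AlgebraicGeometry.Motives

variable {n m : ℕ} {X Y Z C T T' : SchemeOver ℂ}

/-! ### §2 Hodge consequences for rationally chain connected and Fano varieties -/

/-- **`HC(X)` for every rationally chain connected smooth projective complex variety of dimension `≤ 5`** (`CH₀ ⊗ ℚ` of rank `≤ 1`, `dim ≤ 2·0 + 5`; Laterveer / Vial cycle-level, g33-#7).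
[cite: Vial2013, Thm 7.1 (first item)] [cite: BlochSrinivas1983, Thm. 1] [cite: VoisinHodgeII2003, Thm. 10.17 and Prop. 10.26] [cite: Kollar1995, Def. 4.10] -/
theorem hodgeConjectureFor_of_isRationallyChainConnected (hX : IsSmoothProjective n X) (hRC : IsRationallyChainConnected X) (hn : n ≤ 5) : HodgeConjectureFor n X :=
  hodgeConjectureFor_of_chowRankLEOneUpTo hX (hRC.chowRankLEOneUpTo_zero hX) (by omega)

/-- **`HC(F)` for every smooth complex FANO variety of dimension `≤ 5`, granted KMM92.** [cite: KollarMiyaokaMori1992, Thm. 3.3] [cite: Vial2013, Thm 7.1 (first item)] [cite: BlochSrinivas1983, Thm. 1] -/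
theorem hodgeConjectureFor_of_isFano (hKMM : KollarMiyaokaMori1992_fano_rationallyChainConnected) {F : SchemeOver ℂ} (hF : IsFano n F) (hn : n ≤ 5) : HodgeConjectureFor n F :=
  hodgeConjectureFor_of_chowRankLEOneUpTo hF.isSmoothProjective (hKMM.chowRankLEOneUpTo_zero hF) (by omega)

/-- **ALL of Grothendieck's amended `GHC` for every rationally chain connected smooth projective variety of dimension `≤ 4`** (g33-#9 with `k₀ = 0`). [cite: GrothendieckTopology1969, §1, pp. 300–301]
[cite: BlochSrinivas1983, Thm. 1] [cite: VoisinHodgeII2003, Thm. 10.17 and Prop. 10.26] [cite: Voisin2025, §5.2 Cor. 5.7, §4.3] -/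
theorem forall_generalHodgePropertyFor_of_isRationallyChainConnected (hX : IsSmoothProjective n X) (hRC : IsRationallyChainConnected X) (hn : n ≤ 4) (i r : ℕ) :
    GeneralHodgePropertyFor n X i r :=
  forall_generalHodgePropertyFor_of_chowRankLEOneUpTo hX (hRC.chowRankLEOneUpTo_zero hX) (by omega) i r

/-- **Rationally chain connected FIVEFOLDS: all of `GHC(X)` ⟺ `GHC(X, 5, 2)`.** [cite: GrothendieckTopology1969, §1, pp. 300–301] [cite: BlochSrinivas1983, Thm. 1] [cite: Voisin2025, §4.3] -/
theorem forall_generalHodgePropertyFor_dim_five_iff_of_isRationallyChainConnected (hX : IsSmoothProjective 5 X) (hRC : IsRationallyChainConnected X) :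
    (∀ i r : ℕ, GeneralHodgePropertyFor 5 X i r) ↔ GeneralHodgePropertyFor 5 X 5 2 :=
  forall_generalHodgePropertyFor_dim_five_iff_of_chowRankLEOneUpTo_zero hX (hRC.chowRankLEOneUpTo_zero hX)

/-- **`HC(Y × Z)` for two rationally chain connected smooth projective varieties with `dim Y ≤ 5`, `dim Z ≤ 5`, `dim Y + dim Z ≤ 7`** (e.g. a rationally connected fourfold times a Fano threefold; g33-#7 with
`k₀ = k₁ = 0`). [cite: VoisinHodgeII2003, Thm. 10.17, Thm. 10.29 and proof of Thm. 10.31] [cite: BlochSrinivas1983, Thm. 1] [cite: Voisin2013GHCBloch, Lemma 2.1 (proof)] [cite: VoisinHodgeI2002, §11.3.3 Thm. 11.38, Lemma 11.41 and p. 287] -/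
theorem hodgeConjectureFor_tensor_of_isRationallyChainConnected_of_add_le_seven (hY : IsSmoothProjective m Y) (hZ : IsSmoothProjective n Z) (hRCY : IsRationallyChainConnected Y) (hRCZ : IsRationallyChainConnected Z)
    (hm : m ≤ 5) (hn : n ≤ 5) (hmn : m + n ≤ 7) : HodgeConjectureFor (m + n) (Y ⊗ Z) :=
  hodgeConjectureFor_tensor_of_chowRankLEOneUpTo hY hZ (hRCY.chowRankLEOneUpTo_zero hY) (hRCZ.chowRankLEOneUpTo_zero hZ) (by omega) (by omega) (by omega)

/-- **`HC(F × F')` for two smooth complex FANO varieties with `dim F ≤ 5`, `dim F' ≤ 5`, `dim F + dim F' ≤ 7`, granted KMM92.** [cite: KollarMiyaokaMori1992, Thm. 3.3] [cite: VoisinHodgeII2003, Thm. 10.17 and Thm. 10.29]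
[cite: Voisin2013GHCBloch, Lemma 2.1 (proof)] -/
theorem hodgeConjectureFor_tensor_of_isFano_of_add_le_seven (hKMM : KollarMiyaokaMori1992_fano_rationallyChainConnected) {F F' : SchemeOver ℂ} (hF : IsFano m F) (hF' : IsFano n F') (hm : m ≤ 5) (hn : n ≤ 5)
    (hmn : m + n ≤ 7) : HodgeConjectureFor (m + n) (F ⊗ F') :=
  hodgeConjectureFor_tensor_of_chowRankLEOneUpTo hF.isSmoothProjective hF'.isSmoothProjective (hKMM.chowRankLEOneUpTo_zero hF) (hKMM.chowRankLEOneUpTo_zero hF') (by omega) (by omega) (by omega)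

/-- **`HC(Y × Z)` for `Y` rationally chain connected and ANY smooth projective `Z` of dimension `≤ 3` with `dim Y + dim Z ≤ 5`** (rationally connected fourfold × curve, threefold × surface, …).
[cite: VoisinHodgeII2003, Thm. 10.17 and Thm. 10.29] [cite: BlochSrinivas1983, Thm. 1] [cite: Voisin2013GHCBloch, Lemma 2.1 (proof)] [cite: VoisinHodgeI2002, §11.3.3 Thm. 11.38, Lemma 11.41 and p. 287] -/
theorem hodgeConjectureFor_tensor_of_isRationallyChainConnected_of_dim_le_three (hY : IsSmoothProjective m Y) (hZ : IsSmoothProjective n Z) (hRC : IsRationallyChainConnected Y) (hn : n ≤ 3)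
    (hmn : m + n ≤ 5) : HodgeConjectureFor (m + n) (Y ⊗ Z) :=
  hodgeConjectureFor_tensor_of_chowRankLEOneUpTo_of_dim_le_three hY hZ (hRC.chowRankLEOneUpTo_zero hY) hn (by omega)

/-- **ALL of Grothendieck's amended `GHC` for `T × T'`, two rationally chain connected smooth projective THREEFOLDS** (g33-#11 `forall_generalHodgePropertyFor_tensor_threefolds_of_chowRankLEOneUpTo_zero`).
[cite: GrothendieckTopology1969, §1, pp. 300–301] [cite: BlochSrinivas1983, Thm. 1] [cite: VoisinHodgeII2003, §10.2.2 Thm. 10.17 and §9.2.4 Prop. 9.20] [cite: VoisinHodgeI2002, §11.3.3 Thm. 11.38] [cite: Kollar1995, Def. 4.10] -/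
theorem forall_generalHodgePropertyFor_tensor_threefolds_of_isRationallyChainConnected (hT : IsSmoothProjective 3 T) (hT' : IsSmoothProjective 3 T') (hRC : IsRationallyChainConnected T)
    (hRC' : IsRationallyChainConnected T') (i r : ℕ) : GeneralHodgePropertyFor (3 + 3) (T ⊗ T') i r :=
  forall_generalHodgePropertyFor_tensor_threefolds_of_chowRankLEOneUpTo_zero hT hT' (hRC.chowRankLEOneUpTo_zero hT) (hRC'.chowRankLEOneUpTo_zero hT') i r

/-- **ALL of `GHC(F × F')` for two FANO threefolds, granted KMM92.** [cite: KollarMiyaokaMori1992, Thm. 3.3] [cite: GrothendieckTopology1969, §1, pp. 300–301] [cite: BlochSrinivas1983, Thm. 1] [cite: MurreTorino1994, §5.8.1] -/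
theorem forall_generalHodgePropertyFor_tensor_threefolds_of_isFano (hKMM : KollarMiyaokaMori1992_fano_rationallyChainConnected) {F F' : SchemeOver ℂ} (hF : IsFano 3 F) (hF' : IsFano 3 F')
    (i r : ℕ) : GeneralHodgePropertyFor (3 + 3) (F ⊗ F') i r :=
  forall_generalHodgePropertyFor_tensor_threefolds_of_chowRankLEOneUpTo_zero hF.isSmoothProjective hF'.isSmoothProjective (hKMM.chowRankLEOneUpTo_zero hF) (hKMM.chowRankLEOneUpTo_zero hF') i r

/-- **ALL of `GHC(C × T)` for any smooth projective curve `C` and a rationally chain connected threefold `T`.** [cite: GrothendieckTopology1969, §1, pp. 300–301] [cite: BlochSrinivas1983, Thm. 1]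
[cite: VoisinHodgeII2003, §10.2.2 Thm. 10.17 and §9.2.4 Prop. 9.20] [cite: VoisinHodgeI2002, §11.3.3 Thm. 11.38] -/
theorem forall_generalHodgePropertyFor_curve_tensor_threefold_of_isRationallyChainConnected (hC : IsSmoothProjective 1 C) (hT : IsSmoothProjective 3 T) (hRC : IsRationallyChainConnected T) (i r : ℕ) :
    GeneralHodgePropertyFor (1 + 3) (C ⊗ T) i r :=
  forall_generalHodgePropertyFor_curve_tensor_threefold_of_chowRankLEOneUpTo_zero hC hT (hRC.chowRankLEOneUpTo_zero hT) i r

/-- Mirror: **ALL of `GHC(T × C)`**, `T` rationally chain connected threefold, `C` any curve. [cite: GrothendieckTopology1969, §1, pp. 300–301] [cite: BlochSrinivas1983, Thm. 1] [cite: VoisinHodgeI2002, §11.3.3 Thm. 11.38] -/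
theorem forall_generalHodgePropertyFor_threefold_tensor_curve_of_isRationallyChainConnected (hT : IsSmoothProjective 3 T) (hC : IsSmoothProjective 1 C) (hRC : IsRationallyChainConnected T) (i r : ℕ) :
    GeneralHodgePropertyFor (3 + 1) (T ⊗ C) i r :=
  forall_generalHodgePropertyFor_threefold_tensor_curve_of_chowRankLEOneUpTo_zero hT hC (hRC.chowRankLEOneUpTo_zero hT) i r

/-- **ALL of `GHC(C × F)` and of `GHC(F × C)` for any curve `C` and a FANO threefold `F`, granted KMM92.** [cite: KollarMiyaokaMori1992, Thm. 3.3] [cite: GrothendieckTopology1969, §1, pp. 300–301] [cite: BlochSrinivas1983, Thm. 1] -/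
theorem forall_generalHodgePropertyFor_curve_tensor_threefold_of_isFano (hKMM : KollarMiyaokaMori1992_fano_rationallyChainConnected) (hC : IsSmoothProjective 1 C) {F : SchemeOver ℂ} (hF : IsFano 3 F)
    (i r : ℕ) : GeneralHodgePropertyFor (1 + 3) (C ⊗ F) i r ∧ GeneralHodgePropertyFor (3 + 1) (F ⊗ C) i r :=
  ⟨forall_generalHodgePropertyFor_curve_tensor_threefold_of_chowRankLEOneUpTo_zero hC hF.isSmoothProjective (hKMM.chowRankLEOneUpTo_zero hF) i r,
    forall_generalHodgePropertyFor_threefold_tensor_curve_of_chowRankLEOneUpTo_zero hF.isSmoothProjective hC (hKMM.chowRankLEOneUpTo_zero hF) i r⟩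

/-- **ALL of `GHC(T × X)` for a rationally chain connected threefold `T` and a fivefold `X` with `CH₀, CH₁ ⊗ ℚ` of rank `≤ 1`** (g33-#11). [cite: GrothendieckTopology1969, §1, pp. 300–301] [cite: BlochSrinivas1983, Thm. 1]
[cite: VoisinHodgeII2003, Thm. 10.17, Thm. 10.29 and proof of Thm. 10.31] -/
theorem forall_generalHodgePropertyFor_threefold_tensor_fivefold_of_isRationallyChainConnected_of_chowRankLEOneUpTo_one (hT : IsSmoothProjective 3 T) (hX : IsSmoothProjective 5 X)
    (hRC : IsRationallyChainConnected T) (hCH : ChowRankLEOneUpTo X 1) (i r : ℕ) : GeneralHodgePropertyFor (3 + 5) (T ⊗ X) i r :=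
  forall_generalHodgePropertyFor_threefold_tensor_fivefold_of_chowRankLEOneUpTo_zero_one hT hX (hRC.chowRankLEOneUpTo_zero hT) hCH i r

end Literature.AlgebraicGeometry.HodgeTheory

end
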